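import Literature.NumberTheory.EllipticCurves.CanonicalPAdicHeightCycLocusTwoProofs
import Literature.RingTheory.KTheory.MilnorKNormBoundaryCompatPrimeDegree
import Literature.NumberTheory.NumberFields.ArithmeticEquivalence
import HarnessLib

/-!
# The canonical cyclotomic `p`-adic height over a number field `H`: Galois invariance of the height
# formula and Galois stability of the `2`-adic locus subgroup (proofs only)

Trunk T-NT-EC (`Literature/NumberTheory/EllipticCurves`). Pure proof file (no definitions, no named
facts); second file of the programme proving `WeierstrassCurve.exists_isCanonicalCyc`
(`CanonicalPAdicHeightCyc.lean`) at `p = 2` from a sigma-squared pair. The named fact asks for a datum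
that is invariant under `Aut(H/ℚ)` acting on `E(H)` (`pointGalHom`); the existence proof obtains it by
AVERAGING over the finite group `Aut(H/ℚ)` a pairing whose quadratic form on the locus subgroup `G`
(`exists_addSubgroup_cycLocus_two`) is the height formula `canonicalPAdicHeightCyc`. Averaging
preserves that property iff (a) `G` is `Aut(H/ℚ)`-stable and (b) the formula is `Aut(H/ℚ)`-invariant
— the two facts of this file. Both are the remark «on admissible points this is visible on the
formula: `N𝔡`, `N_{H/ℚ}`, `Tr_{H/ℚ}` are Galois-invariant» of the docstring of `exists_isCanonicalCyc`
(Disegni 2017 §1.3.1: «its equivariance properties under the action of `𝒢_F`»).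

PROVED:

* `canonicalPAdicHeightCyc_pointGalHom` — `ĥ_{p,H}(σP) = ĥ_{p,H}(P)` for every `σ ∈ Aut(H/ℚ)`, every
  prime `p` and every `P ∈ E(H)` (`N𝔡(σx) = N𝔡(x)` by transport of the denominator ideal along
  `σ|𝓞_H`; `N(σz) = N(z)`, `Tr((σz)ⁿ) = Tr(zⁿ)`);
* `hasNonsingularReductionAtK_algEquiv_iff`, `one_lt_valuation_algEquiv_iff` — the place-wise
  conditions at `v` for `σP` are the conditions at `σ⁻¹v` for `P` (tree: `w_𝔓 ∘ σ = w_{σ⁻¹𝔓}`,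
  `MilnorK.valuation_algEquiv_apply`);
* `exists_addSubgroup_cycLocus_two_galois` — the subgroup of `exists_addSubgroup_cycLocus_two`
  (torsion-free, containing the `2`-adic admissible locus) can be taken `Aut(H/ℚ)`-STABLE (its
  membership conditions are «at every prime above `2`» and «at every finite place», sets of places
  permuted by `σ`).

## Sources

* D. Disegni, Compos. Math. 153 (2017), §1.3.1 (arXiv v3 p. 7 L38: Galois equivariance of the pairing).
* B. Mazur, W. Stein, J. Tate, Doc. Math. Extra Vol. Coates (2006), §2.8 (the formula over a number field).
* P. Gille, T. Szamuely, CSAGC (2006), Appendix A.6 (`(σ, w) ↦ w ∘ σ` on the primes above `𝔭`).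
-/

noncomputable section

open scoped Classical
open IsDedekindDomain NumberField WeierstrassCurve
open Literature.RingTheory.KTheory.MilnorK (galComapPrime valuation_algEquiv_apply galComapPrime_asIdeal)

namespace Literature.NumberTheory.EllipticCurves

variable (W : WeierstrassCurve ℚ) (H : Type) [Field H] [NumberField H]

/-! ### Places: the conditions at `v` for `σP` are the conditions at `σ⁻¹v` for `P` -/

variable {H} in
/-- `σ⁻¹w` contains `p` iff `w` does (the restriction of `σ` to `𝓞_H` fixes `ℤ`).
[cite: GilleSzamuely2006, Appendix A.6 (p. 347)] -/
theorem natCast_mem_galComapPrime_iff (σ : H ≃ₐ[ℚ] H) (w : HeightOneSpectrum (𝓞 H)) (p : ℕ) :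
    ((p : ℕ) : 𝓞 H) ∈ (galComapPrime ℤ (𝓞 H) σ w).asIdeal ↔ ((p : ℕ) : 𝓞 H) ∈ w.asIdeal := by
  rw [galComapPrime_asIdeal, Ideal.mem_comap, map_natCast]

variable {W H} in
/-- **`σP ∈ E₀` at `v` iff `P ∈ E₀` at `σ⁻¹v`**: the coordinate predicate `HasNonsingularReductionAtK`
is built from valuations of polynomial expressions in `x, y` with rational coefficients, and
`v(σa) = (σ⁻¹v)(a)`. [cite: GilleSzamuely2006, Appendix A.6 Proposition A.6.3 (1) (p. 347)] -/
theorem hasNonsingularReductionAtK_algEquiv_iff (σ : H ≃ₐ[ℚ] H) (v : HeightOneSpectrum (𝓞 H))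
    (x y : H) :
    W.HasNonsingularReductionAtK H v (σ x) (σ y) ↔
      W.HasNonsingularReductionAtK H (galComapPrime ℤ (𝓞 H) σ v) x y := by
  have hX : (W.baseChange H).toAffine.polynomialX.evalEval (σ x) (σ y) =
      σ ((W.baseChange H).toAffine.polynomialX.evalEval x y) := by
    rw [WeierstrassCurve.Affine.evalEval_polynomialX, WeierstrassCurve.Affine.evalEval_polynomialX]
    simp only [WeierstrassCurve.baseChange, WeierstrassCurve.map_a₁, WeierstrassCurve.map_a₂,
      WeierstrassCurve.map_a₄, map_sub, map_add, map_mul, map_pow, map_ofNat, AlgEquiv.commutes]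
  have hY : (W.baseChange H).toAffine.polynomialY.evalEval (σ x) (σ y) =
      σ ((W.baseChange H).toAffine.polynomialY.evalEval x y) := by
    rw [WeierstrassCurve.Affine.evalEval_polynomialY, WeierstrassCurve.Affine.evalEval_polynomialY]
    simp only [WeierstrassCurve.baseChange, WeierstrassCurve.map_a₁, WeierstrassCurve.map_a₃,
      map_add, map_mul, map_ofNat, AlgEquiv.commutes]
  unfold WeierstrassCurve.HasNonsingularReductionAtK
  rw [hX, hY, valuation_algEquiv_apply (A := ℤ), valuation_algEquiv_apply (A := ℤ),
    valuation_algEquiv_apply (A := ℤ)]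

variable {H} in
/-- `1 < v(c · σx) ↔ 1 < (σ⁻¹v)(c · x)` for a rational constant `c` (used with `c = 4`).
[cite: GilleSzamuely2006, Appendix A.6 Proposition A.6.3 (1) (p. 347)] -/
theorem one_lt_valuation_mul_algEquiv_iff (σ : H ≃ₐ[ℚ] H) (v : HeightOneSpectrum (𝓞 H))
    (c : ℚ) (x : H) :
    1 < v.valuation H ((c : H) * σ x) ↔ 1 < (galComapPrime ℤ (𝓞 H) σ v).valuation H ((c : H) * x) := by
  have : (c : H) * σ x = σ ((c : H) * x) := by
    rw [map_mul, show ((c : H)) = algebraMap ℚ H c from rfl, AlgEquiv.commutes]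
  rw [this, valuation_algEquiv_apply (A := ℤ)]

/-! ### Invariance of the height formula -/

variable {H} in
/-- **The denominator ideal is transported by `σ`**: `𝔡(σx) = (σ⁻¹|𝓞_H)⁻¹ 𝔡(x)`, i.e.
`r ∈ 𝔡(σx) ↔ σ⁻¹(r) ∈ 𝔡(x)`. [cite: MazurSteinTate2006, §2.8 (PDF p. 11)] -/
theorem denominatorIdeal_algEquiv (σ : H ≃ₐ[ℚ] H) (x : H) :
    WeierstrassCurve.denominatorIdeal H (σ x) =
      (WeierstrassCurve.denominatorIdeal H x).comap
        (galRestrict ℤ ℚ H (𝓞 H) σ.symm : 𝓞 H →+* 𝓞 H) := by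
  have key : ∀ (τ : H ≃ₐ[ℚ] H) (r : 𝓞 H),
      ((galRestrict ℤ ℚ H (𝓞 H) τ r : 𝓞 H) : H) = τ ((r : 𝓞 H) : H) := fun τ r =>
    algebraMap_galRestrict_apply ℤ τ r
  have key' : ∀ (τ : H ≃ₐ[ℚ] H) (r : 𝓞 H),
      (((galRestrict ℤ ℚ H (𝓞 H) τ : 𝓞 H →+* 𝓞 H) r : 𝓞 H) : H) = τ ((r : 𝓞 H) : H) := key
  ext r
  simp only [WeierstrassCurve.denominatorIdeal, Submodule.mem_mk, AddSubmonoid.mem_mk,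
    AddSubsemigroup.mem_mk, Set.mem_setOf_eq, Ideal.mem_comap]
  constructor
  · rintro ⟨s, hs⟩
    refine ⟨galRestrict ℤ ℚ H (𝓞 H) σ.symm s, ?_⟩
    rw [key, key', ← hs, map_mul, AlgEquiv.symm_apply_apply]
  · rintro ⟨s, hs⟩
    refine ⟨galRestrict ℤ ℚ H (𝓞 H) σ s, ?_⟩
    rw [key'] at hs
    rw [key]
    have := congrArg σ hs
    rwa [map_mul, AlgEquiv.apply_symm_apply] at this

variable {H} in
/-- **`N𝔡(σx) = N𝔡(x)`.** [cite: MazurSteinTate2006, §2.8 (PDF p. 11)] -/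
theorem absNorm_denominatorIdeal_algEquiv (σ : H ≃ₐ[ℚ] H) (x : H) :
    Ideal.absNorm (WeierstrassCurve.denominatorIdeal H (σ x)) =
      Ideal.absNorm (WeierstrassCurve.denominatorIdeal H x) := by
  rw [denominatorIdeal_algEquiv]
  set I := WeierstrassCurve.denominatorIdeal H x
  set f : 𝓞 H →+* 𝓞 H := (galRestrict ℤ ℚ H (𝓞 H) σ.symm : 𝓞 H →+* 𝓞 H) with hf
  have hfs : Function.Surjective f := (galRestrict ℤ ℚ H (𝓞 H) σ.symm).surjective
  rw [Ideal.absNorm_apply, Ideal.absNorm_apply, Submodule.cardQuot_apply, Submodule.cardQuot_apply]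
  refine Nat.card_congr (Ideal.quotientEquiv (I.comap f) I
    (galRestrict ℤ ℚ H (𝓞 H) σ.symm).toRingEquiv ?_).toEquiv
  exact (Ideal.map_comap_of_surjective f hfs I).symm

variable {W H} in
/-- **Galois invariance of the cyclotomic height formula**: `ĥ_{p,H}(σP) = ĥ_{p,H}(P)` for every
`σ ∈ Aut(H/ℚ)` and every `P ∈ E(H)` — on `P = (x, y)` the formula is
`log_p N𝔡(x) − 2 log_p N_{H/ℚ}(z) − Σ' ℒₙ Tr_{H/ℚ}(zⁿ)`, `z = −x/y`, and `N𝔡`, `N_{H/ℚ}`, `Tr_{H/ℚ}` are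
invariant under `σ`. [cite: Disegni2017, §1.3.1 (arXiv v3 PDF p. 7 L38)]
[cite: MazurSteinTate2006, §2.8 (PDF p. 11 L33–58)] -/
theorem canonicalPAdicHeightCyc_pointGalHom (p : ℕ) [Fact p.Prime] (σ : H ≃ₐ[ℚ] H)
    (P : (W.baseChange H).toAffine.Point) :
    W.canonicalPAdicHeightCyc p H (pointGalHom W H σ P) = W.canonicalPAdicHeightCyc p H P := by
  rcases P with _ | ⟨x, y, h⟩
  · rfl
  · rw [pointGalHom_apply, WeierstrassCurve.Affine.Point.map_some,
      WeierstrassCurve.canonicalPAdicHeightCyc_some, WeierstrassCurve.canonicalPAdicHeightCyc_some]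
    have hσ : ∀ a : H, (σ : H →ₐ[ℚ] H) a = σ a := fun a => rfl
    have hz : -((σ : H →ₐ[ℚ] H) x) / (σ : H →ₐ[ℚ] H) y = σ (-x / y) := by
      rw [hσ, hσ, map_div₀, map_neg]
    rw [hz, hσ, WeierstrassCurve.sigmaSqNormLog_def, WeierstrassCurve.sigmaSqNormLog_def,
      Algebra.norm_eq_of_algEquiv, absNorm_denominatorIdeal_algEquiv]
    congr 2
    refine tsum_congr fun n => ?_
    rw [← map_pow, Algebra.trace_eq_of_algEquiv]

/-! ### The `2`-adic locus subgroup can be taken `Aut(H/ℚ)`-stable -/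

/-- **The torsion-free subgroup containing the `2`-adic admissible locus is `Aut(H/ℚ)`-stable.**
For `W/ℚ` with integer coefficients and a number field `H`, the subgroup `G ≤ E(H)` of
`exists_addSubgroup_cycLocus_two` — (i) torsion-free, (ii) affine members = points with `1 < w(4x)`
at every prime `w ∋ 2` and non-singular reduction at every finite place, (iii) containing every point
with `SatisfiesLocalConditionsCyc 2`, (iv) members have `1 < w(x)`, `w(−x/y) < w(2)` at `w ∋ 2` —
satisfies moreover (v) `σ(G) ⊆ G` for every `σ ∈ Aut(H/ℚ)` (`pointGalHom`), since `σ` permutes the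
primes above `2` and the finite places and `v(σa) = (σ⁻¹v)(a)`.
[cite: Disegni2017, §1.3.1 (arXiv v3 PDF p. 7 L38)] [cite: SilvermanAEC2009, VII.2.1–2.2 and VII.3.1]
[cite: GilleSzamuely2006, Appendix A.6 Proposition A.6.3 (1) (p. 347)] -/
theorem exists_addSubgroup_cycLocus_two_galois [W.IsIntegral ℤ] :
    ∃ G : AddSubgroup (W.baseChange H).toAffine.Point,
      (∀ P ∈ G, IsOfFinAddOrder P → P = 0) ∧
      (∀ {x y : H} (h : (W.baseChange H).toAffine.Nonsingular x y),
        (.some x y h : (W.baseChange H).toAffine.Point) ∈ G ↔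
          (∀ w : HeightOneSpectrum (𝓞 H), ((2 : ℕ) : 𝓞 H) ∈ w.asIdeal →
              1 < w.valuation H (4 * x)) ∧
            ∀ v : HeightOneSpectrum (𝓞 H), W.HasNonsingularReductionAtK H v x y) ∧
      (∀ P, W.SatisfiesLocalConditionsCyc 2 H P → P ∈ G) ∧
      (∀ {x y : H} (h : (W.baseChange H).toAffine.Nonsingular x y),
        (.some x y h : (W.baseChange H).toAffine.Point) ∈ G →
          ∀ w : HeightOneSpectrum (𝓞 H), ((2 : ℕ) : 𝓞 H) ∈ w.asIdeal →
            1 < w.valuation H x ∧ w.valuation H (-x / y) < w.valuation H (2 : H)) ∧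
      (∀ (σ : H ≃ₐ[ℚ] H) (P : (W.baseChange H).toAffine.Point),
        P ∈ G → pointGalHom W H σ P ∈ G) := by
  obtain ⟨G, htf, hmem, hloc, hfacts⟩ := exists_addSubgroup_cycLocus_two W H
  refine ⟨G, htf, hmem, hloc, hfacts, fun σ P hP => ?_⟩
  rcases P with _ | ⟨x, y, h⟩
  · rw [← WeierstrassCurve.Affine.Point.zero_def, map_zero]; exact G.zero_mem
  · rw [pointGalHom_apply, WeierstrassCurve.Affine.Point.map_some]
    obtain ⟨h4, hns⟩ := (hmem h).mp hP
    refine (hmem _).mpr ⟨fun w hw => ?_, fun v => ?_⟩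
    · have h4' := (one_lt_valuation_mul_algEquiv_iff σ w 4 x).mpr
        (by
          rw [Rat.cast_ofNat]
          exact h4 _ ((natCast_mem_galComapPrime_iff σ w 2).mpr hw))
      rw [Rat.cast_ofNat] at h4'
      exact h4'
    · exact (hasNonsingularReductionAtK_algEquiv_iff σ v x y).mpr (hns _)

end Literature.NumberTheory.EllipticCurves

end
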